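import Literature.MathematicalPhysics.QuantumManyBody.GroundStateFeynmanKac
import HarnessLib

/-!
# Crux `GroundStateRigidity` (stmt-AtomisticToContinuum-9072), line `Sketch`:
# the registered stub `stub_polygonalChain`

Supports (does not close) stmt-AtomisticToContinuum-9072; stub `stub_polygonalChain` of line
Sketch (Stub 17). **Polygonal chains with clearance in the free region.** Two configurations
`X, Y ∈ (ℝ³)^N` joined by a continuous path inside the free region
`F = {Z ∈ Λ_L^N | |zᵢ - zⱼ| > b for all i ≠ j}` of `N` hard spheres are joined by a finite chain of
straight segments `[Z l, Z (l+1)]`, `Z 0 = X`, `Z k = Y`, with all vertices in the open box and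
along which every pair difference keeps norm `≥ b + 2m` for some `m > 0`.

## Proof

Let `γ : [0,1] → F` be the path. For each pair `i ≠ j` the continuous function
`t ↦ |γ(t)ᵢ - γ(t)ⱼ|` attains its minimum on the compact `[0,1]`, which is `> b`; minimising over
the finitely many pairs gives `m > 0` with `|γ(t)ᵢ - γ(t)ⱼ| ≥ b + 4m` for all `t` and `i ≠ j`
(`PolygonalChain.exists_uniform_clearance`). By uniform continuity of `γ` on `[0,1]`
(Heine–Cantor) there is `δ > 0` with `dist (γ s) (γ t) < m` for `|s - t| < δ`; choose `k ≥ 1` with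
`1/k < δ` and put `Z l := γ(l/k)` (the path extended constantly outside `[0,1]`). Consecutive
vertices are then `m`-close in the sup metric of `(ℝ³)^N`, so along the segment
`θ ↦ (1-θ) Z l + θ Z (l+1)` the pair difference
`(1-θ)(Z l i - Z l j) + θ(Z (l+1) i - Z (l+1) j)` differs from `Z l i - Z l j` by at most
`θ (|Z l i - Z (l+1) i| + |Z l j - Z (l+1) j|) ≤ 2m`, whence its norm is `≥ (b + 4m) - 2m`
(`PolygonalChain.segment_pair_bound`). The vertices are path points, hence lie in the box.
-/

noncomputable section

open MeasureTheory Filter Set Metric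
open scoped ENNReal NNReal Topology

namespace Summit.AtomisticToContinuum.BoseEinsteinCondensation.Theorems.GroundStateRigidity

open Literature.MathematicalPhysics.QuantumManyBody.BoseGas

namespace PolygonalChain

variable {N : ℕ}

/-- **Uniform clearance along a path of collision-free configurations.** If every pair distance
is `> b` along a path `γ : [0,1] → (ℝ³)^N`, then for some `m > 0` every pair distance is
`≥ b + 4m` along `γ` (minimum of a positive continuous function on the compact `[0,1]`, finitely
many pairs; `m = 1/4` if there is no pair). [folklore] -/
theorem exists_uniform_clearance {X Y : Config N} {b : ℝ} (γ : Path X Y)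
    (hγ : ∀ t, ∀ i j : Fin N, i ≠ j → b < dist (γ t i) (γ t j)) :
    ∃ m : ℝ, 0 < m ∧ ∀ t, ∀ i j : Fin N, i ≠ j → b + 4 * m ≤ dist (γ t i) (γ t j) := by
  -- per pair: a positive minimum of the clearance along the path
  have hpair : ∀ i j : Fin N, ∃ mp : ℝ, 0 < mp ∧
      (i ≠ j → ∀ t, b + mp ≤ dist (γ t i) (γ t j)) := by
    intro i j
    by_cases hij : i = j
    · exact ⟨1, one_pos, fun h => absurd hij h⟩
    · have hfc : Continuous fun t : unitInterval => dist (γ t i) (γ t j) :=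
        ((continuous_apply i).comp γ.continuous).dist ((continuous_apply j).comp γ.continuous)
      obtain ⟨t₀, -, hmin⟩ :=
        isCompact_univ.exists_isMinOn Set.univ_nonempty hfc.continuousOn
      refine ⟨dist (γ t₀ i) (γ t₀ j) - b, sub_pos.2 (hγ t₀ i j hij), fun _ t => ?_⟩
      have ht : dist (γ t₀ i) (γ t₀ j) ≤ dist (γ t i) (γ t j) :=
        (isMinOn_iff.1 hmin) t (Set.mem_univ t)
      linarith
  choose mp hmp0 hmp using hpair
  -- minimum over the finitely many pairs
  obtain ⟨m, hm0, hmle⟩ : ∃ m : ℝ, 0 < m ∧ ∀ i j : Fin N, m ≤ mp i j := by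
    rcases isEmpty_or_nonempty (Fin N × Fin N) with hι | hι
    · exact ⟨1, one_pos, fun i j => hι.elim (i, j)⟩
    · obtain ⟨p, hp⟩ := Finite.exists_min fun p : Fin N × Fin N => mp p.1 p.2
      exact ⟨_, hmp0 p.1 p.2, fun i j => hp (i, j)⟩
  refine ⟨m / 4, by positivity, fun t i j hij => ?_⟩
  have h1 := hmp i j hij t
  have h2 := hmle i j
  linarith

/-- **Heine–Cantor for a path**, in `ε`–`δ` form: a path on `[0,1]` with values in a metric space
is uniformly continuous. [folklore] -/
theorem exists_modulus {E : Type*} [PseudoMetricSpace E] {X Y : E} (γ : Path X Y) {ε : ℝ}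
    (hε : 0 < ε) :
    ∃ δ : ℝ, 0 < δ ∧ ∀ s t : unitInterval, dist s t < δ → dist (γ s) (γ t) < ε := by
  have huc : UniformContinuous γ := CompactSpace.uniformContinuous_of_continuous γ.continuous
  obtain ⟨δ, hδ, h⟩ := Metric.uniformContinuous_iff.1 huc ε hε
  exact ⟨δ, hδ, fun s t hst => h hst⟩

/-- **Pair differences along a short segment keep their clearance.** If two configurations
`A, B ∈ (ℝ³)^N` are `m`-close in the sup metric and all pair distances of `A` are `≥ b + 4m`, then
along the segment `θ ↦ (1-θ) A + θ B`, `θ ∈ [0,1]`, every pair difference has norm `≥ b + 2m`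
(triangle inequality: the pair difference moves by at most `θ · 2 dist A B ≤ 2m`). [folklore] -/
theorem segment_pair_bound {A B : Config N} {b m : ℝ} (hAB : dist A B < m)
    (hA : ∀ i j : Fin N, i ≠ j → b + 4 * m ≤ dist (A i) (A j))
    {θ : ℝ} (hθ : θ ∈ Set.Icc (0 : ℝ) 1) {i j : Fin N} (hij : i ≠ j) :
    b + 2 * m ≤ ‖(1 - θ) • (A i - A j) + θ • (B i - B j)‖ := by
  have h1 : ‖A i - B i‖ ≤ dist A B := by
    rw [← dist_eq_norm]
    exact dist_le_pi_dist A B i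
  have h2 : ‖A j - B j‖ ≤ dist A B := by
    rw [← dist_eq_norm]
    exact dist_le_pi_dist A B j
  have hAij : b + 4 * m ≤ ‖A i - A j‖ := by
    rw [← dist_eq_norm]
    exact hA i j hij
  have hdiff : (A i - A j) - ((1 - θ) • (A i - A j) + θ • (B i - B j)) =
      θ • ((A i - B i) - (A j - B j)) := by
    simp only [smul_sub, sub_smul, one_smul]
    abel
  have hnd : ‖(A i - A j) - ((1 - θ) • (A i - A j) + θ • (B i - B j))‖ ≤ 2 * dist A B := by
    rw [hdiff, norm_smul, Real.norm_eq_abs, abs_of_nonneg hθ.1]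
    calc θ * ‖(A i - B i) - (A j - B j)‖
        ≤ 1 * ‖(A i - B i) - (A j - B j)‖ := by gcongr; exact hθ.2
      _ ≤ ‖A i - B i‖ + ‖A j - B j‖ := by rw [one_mul]; exact norm_sub_le _ _
      _ ≤ 2 * dist A B := by linarith
  have hsub := norm_sub_norm_le (A i - A j) ((1 - θ) • (A i - A j) + θ • (B i - B j))
  linarith

end PolygonalChain

/-- **Stub 17 — polygonal chains with clearance in the free region.** Two configurations joined by a
continuous path inside the (open) free region `{Z ∈ Λ^N : all pairs > b}` are joined by a finite chain
of straight segments with vertices in the open box along which every pair keeps distance `≥ b + 2m`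
for some `m > 0` (uniform continuity of the path on `[0,1]`, a positive minimum of the continuous
clearance `min_{i≠j} (|zᵢ − zⱼ| − b)` on the compact image, Lipschitz dependence of pair distances on
the configuration). [folklore] -/
theorem stub_polygonalChain :
    ∀ (N : ℕ) (L b : ℝ) (X Y : Config N),
      JoinedIn {Z : Config N | Z ∈ boxN N L ∧ ∀ i j : Fin N, i ≠ j → b < dist (Z i) (Z j)} X Y →
      ∃ (k : ℕ) (Z : ℕ → Config N) (m : ℝ), Z 0 = X ∧ Z k = Y ∧ 0 < m ∧
        (∀ l : ℕ, l ≤ k → Z l ∈ boxN N L) ∧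
        ∀ l : ℕ, l < k → ∀ θ : ℝ, θ ∈ Set.Icc (0 : ℝ) 1 → ∀ i j : Fin N, i ≠ j →
          b + 2 * m ≤ ‖(1 - θ) • (Z l i - Z l j) + θ • (Z (l + 1) i - Z (l + 1) j)‖ := by
  intro N L b X Y hJ
  obtain ⟨γ, hγ⟩ := hJ
  -- uniform clearance `b + 4m` along the path, and a modulus of continuity for `m`
  obtain ⟨m, hm, hclear⟩ := PolygonalChain.exists_uniform_clearance γ fun t => (hγ t).2
  obtain ⟨δ, hδ, hmod⟩ := PolygonalChain.exists_modulus γ hm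
  obtain ⟨n, hn⟩ := exists_nat_one_div_lt hδ
  -- `k = n + 1` subdivision points `Z l = γ (l / k)`
  set k : ℕ := n + 1 with hk
  have hkpos : (0 : ℝ) < k := by positivity
  have hkinv : 1 / (k : ℝ) < δ := by
    simpa [hk, Nat.cast_succ] using hn
  have hmemI : ∀ l : ℕ, l ≤ k → (l : ℝ) / k ∈ Set.Icc (0 : ℝ) 1 := fun l hl =>
    ⟨by positivity, div_le_one_of_le₀ (by exact_mod_cast hl) hkpos.le⟩
  refine ⟨k, fun l => γ.extend ((l : ℝ) / k), m, ?_, ?_, hm, ?_, ?_⟩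
  · -- `Z 0 = X`
    simp
  · -- `Z k = Y`
    dsimp only
    rw [div_self hkpos.ne', Path.extend_one]
  · -- vertices lie in the box
    intro l hl
    dsimp only
    rw [Path.extend_apply γ (hmemI l hl)]
    exact (hγ _).1
  · -- clearance along each segment
    intro l hl θ hθ i j hij
    dsimp only
    have hl1 : (l : ℝ) / k ∈ Set.Icc (0 : ℝ) 1 := hmemI l hl.le
    have hl2 : ((l + 1 : ℕ) : ℝ) / k ∈ Set.Icc (0 : ℝ) 1 := hmemI (l + 1) hl
    rw [Path.extend_apply γ hl1, Path.extend_apply γ hl2]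
    refine PolygonalChain.segment_pair_bound ?_ (fun i' j' hij' => hclear _ i' j' hij') hθ hij
    apply hmod
    rw [Subtype.dist_eq, Real.dist_eq]
    have hcalc : (l : ℝ) / k - ((l + 1 : ℕ) : ℝ) / k = -(1 / k) := by
      push_cast
      ring
    rw [hcalc, abs_neg, abs_of_pos (one_div_pos.2 hkpos)]
    exact hkinv

end Summit.AtomisticToContinuum.BoseEinsteinCondensation.Theorems.GroundStateRigidity
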